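/-
COR-CM (cell pub-hodgecm2, stage 2 of the Hodge ladder) — TRANSPOSITION SURGE, item (vi) pinning record, binder `hComp`
(REACH half), TEAM hComp, Shimura-datum / canonical-model record side (seat hcomp-shimura, gen 13).  Sequel of
`HComp/ComplexRecordOfPieces.lean`: the complex record SYSTEM (functor on the small levels, transitions `[z, aK] ↦ [z, aK']`)
is inhabited at every datum of the named fact `exists_recordSystem`.  THEOREMS ONLY: no definition, no instance, no named
fact, nothing asserted; every landed file untouched.  FRAMING: HC_CM is NOT proved; nothing here discharges `hComp`/`h`.
-/
import Summits.HodgeConjecture.CorCM.B01.Transposition.HComp.ComplexRecordOfPieces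
import Summits.HodgeConjecture.CorCM.B01.Transposition.HComp.RecordCarriers
import Summits.HodgeConjecture.CorCM.B01.Transposition.HComp.Levels
import Literature.AlgebraicGeometry.ShimuraVarieties.UnitaryShimuraComplexRecordSystem
import HarnessLib

/-!
# The complex record system of `Sh(U(H), 𝔹²)` below a small level is inhabited at every datum

Main result (namespace `Summit.HodgeConjecture.CorCM.HComp`):

* **`nonempty_complexRecordSystem`** — under EXACTLY the hypotheses of the named fact
  `UnitaryCanonicalModel.exists_recordSystem` ([Deligne1979ShimuraVarieties] 2.2.5 + Cor. 2.7.21; `H` with a frame at `τ`,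
  definite off `τ`, anisotropic; `K₀` open compact with torsion-free conjugate arithmetic levels), the structure
  `UnitaryCanonicalModel.ComplexRecordSystem L H τ T hT K₀` — every clause of Deligne's `RecordSystem` that only sees the complex
  fibres: the functor `K ↦ Mc_K` on `K ≤ K₀`, (C1) smooth projective, (C2a) `pts`, the transitions `[z, aK] ↦ [z, aK']`
  (2.1.4), (C2b) `hol`, (C2c) `pieces` — is INHABITED, with no named fact: one complex record per level
  (`nonempty_complexRecord`, the complex model `∐_q X_q` over the tree's ball quotients) assembled by
  `ComplexRecord.nonempty_complexRecordSystem` (transitions = the `g = 1` Hecke translates between complex records,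
  `ComplexRecord.exists_heckeComplex`; functoriality by uniqueness, `ComplexRecord.hecke_unique`).
* `nonempty_complexRecordSystem_hermSpace3`, `nonempty_complexRecordSystem_K3` — the same at the TEAM's datum: for the tree's
  hermitian 3-space `V : HermSpace3 F ι₁` over a CM field with `4 ≤ [F:ℚ]`, in the frame `Model.frameOf V`
  (`HComp/RecordCarriers`), below any `K₀` with torsion-free conjugate levels, in particular below Liu's threshold `K3 V = K_f(3)`
  (`HComp/Levels`, `torsionFree_arithmeticLevel_conj_K3`) — the `h`-FREE complex twins of the team's `Model.recordAt h V h4 K₀ htf` /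
  `Model.recordOf h V h4` (which read the named fact `h`): same carriers, no hypothesis beyond `4 ≤ [F:ℚ]`.

So the named fact `exists_recordSystem` asserts, beyond theorems of the tree, exactly its ARITHMETIC clauses: the models live
over `L` along `τ` (an `L`-form of this complex system) and (F3) `recip` (Shimura reciprocity (62) at the diagonal special
pairs) — [Deligne1979ShimuraVarieties] 2.2.5 «a form over `E(G,X)` of `M_ℂ(G,X)` … such that … the Galois group acts through
2.2.4».  0 hypothesis binders of Prop-valued named facts (T5: n/a).  HC_CM is NOT proved; S2 is not closed by anything here.

References: P. Deligne, *Variétés de Shimura* (1979), 2.1.2–2.1.4, 2.2.5, Cor. 2.7.21; J. S. Milne, *Introduction to Shimura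
varieties* (2005/2017), Lemma 5.13, Def. 12.10, §13 p. 118.
-/

set_option autoImplicit false

noncomputable section

open scoped Matrix Topology ComplexOrder
open Set Function MulAction Matrix NumberField
open Literature.Geometry.ComplexHyperbolic
open Literature.NumberTheory.Automorphic
open Literature.NumberTheory.Automorphic.UnitaryGroup
open Literature.NumberTheory.Automorphic.Liu2021.AppendixC (C5.OpenCompactSubgroup C5.SmallLevel)
open Literature.AlgebraicGeometry.ShimuraVarieties (hermForm)
open Literature.AlgebraicGeometry.ShimuraVarieties.UnitaryCanonicalModel (ComplexRecord ComplexRecordSystem)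

namespace Summit.HodgeConjecture.CorCM.HComp

variable (L : Type) [Field L] [NumberField L] [IsCMField L] (H : Matrix (Fin 3) (Fin 3) L)
  (τ : L →+* ℂ) (T : GL (Fin 3) ℂ) (hT : formCongr (starRingEnd ℂ) T (H.map τ) = BallModel.J)

/-- **The complex record SYSTEM of Deligne's canonical model is inhabited at every datum** — under EXACTLY the hypotheses
of `UnitaryCanonicalModel.exists_recordSystem` (module docstring): one complex record per small level `K ≤ K₀`
(`nonempty_complexRecord`; torsion-freeness of the conjugate levels descends from `K₀`,
`torsionFree_arithmeticLevel_conj_of_le`), assembled by `ComplexRecord.nonempty_complexRecordSystem`.  No named fact is used.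
[cite: Deligne1979ShimuraVarieties, 2.1.2–2.1.4 (PDF p. 24 of Milne's translation)] [cite: Milne2005ShimuraVarieties, Lemma 5.13 p. 57 and Def. 12.10 p. 115] -/
theorem nonempty_complexRecordSystem
    (hpos : ∀ τ' : L →+* ℂ, InfinitePlace.mk τ' ≠ InfinitePlace.mk τ → (H.map τ').PosDef)
    (hanis : ∀ v : Fin 3 → L, hermForm (cmConjRingHom L) H v v = 0 → v = 0)
    (K₀ : C5.OpenCompactSubgroup ↥(finAdelic (↥(maximalRealSubfield L)) L (IsCMField.complexConj L) 3 H))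
    (htf : ∀ g : finAdelic (↥(maximalRealSubfield L)) L (IsCMField.complexConj L) 3 H,
      ∀ γ ∈ arithmeticLevel (↥(maximalRealSubfield L)) L (IsCMField.complexConj L) 3 H
        (K₀.1.map (MulAut.conj g).toMonoidHom), IsOfFinOrder γ → γ = 1) :
    Nonempty (ComplexRecordSystem L H τ T hT K₀) := by
  have hC : ∀ K : C5.SmallLevel K₀, Nonempty (ComplexRecord L H τ T hT K.1.1) := fun K =>
    nonempty_complexRecord L H τ T hT hpos hanis K.1.1 K.1.2.1 K.1.2.2
      (torsionFree_arithmeticLevel_conj_of_le K.2 htf)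
  obtain ⟨S, -⟩ := ComplexRecord.nonempty_complexRecordSystem fun K => (hC K).some
  exact ⟨S⟩

/-! ## At the team's datum: the tree's hermitian 3-space `V : HermSpace3 F ι₁`, frame `Model.frameOf V` -/

/-- **The `h`-free complex twin of `Model.recordAt h V h4 K₀ htf`**: for the tree's hermitian 3-space `V : HermSpace3 F ι₁` over a
CM field with `4 ≤ [F:ℚ]` (positivity off `ι₁` = `V.posDef_of_ne`, anisotropy = `HermSpace3.anisotropic_of_four_le`, frame
`Model.frameOf V` / `Model.formCongr_frameOf V` of `HComp/RecordCarriers`) and any open compact `K₀ ≤ U(V)(𝔸_{F⁺,f})` with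
torsion-free conjugate arithmetic levels, the complex record system is INHABITED — same carriers as the named term
`Model.recordAt h V h4 K₀ htf : RecordSystem …`, WITHOUT the named fact `h`.
[cite: Deligne1979ShimuraVarieties, 2.1.2–2.1.4 (PDF p. 24 of Milne's translation)] [cite: Milne2005ShimuraVarieties, Lemma 5.13 p. 57] -/
theorem nonempty_complexRecordSystem_hermSpace3 {F : CMField} {ι₁ : F →+* ℂ} (V : HermSpace3 F ι₁)
    (h4 : 4 ≤ Module.finrank ℚ F) (K₀ : C5.OpenCompactSubgroup ↥V.adelicFin)
    (htf : ∀ g : V.adelicFin,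
      ∀ γ ∈ arithmeticLevel (↥(maximalRealSubfield F)) F (IsCMField.complexConj F) 3 V.Hm
        (K₀.1.map (MulAut.conj g).toMonoidHom), IsOfFinOrder γ → γ = 1) :
    Nonempty (ComplexRecordSystem F V.Hm ι₁ (Model.frameOf V) (Model.formCongr_frameOf V) K₀) :=
  nonempty_complexRecordSystem F V.Hm ι₁ (Model.frameOf V) (Model.formCongr_frameOf V) V.posDef_of_ne
    (V.anisotropic_of_four_le h4) K₀ htf

/-- **The `h`-free complex twin of `Model.recordOf h V h4`**: below Liu's threshold `K3 V = K_f(3)` ([Liu2021] App. C l. 4599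
«neat», l. 4627 «sufficiently small»; torsion-freeness `torsionFree_arithmeticLevel_conj_K3` of `HComp/Levels`) the complex record
system of the tree's `V : HermSpace3 F ι₁`, `4 ≤ [F:ℚ]`, is INHABITED with no further hypothesis: every clause of the team's
chosen system `Model.recordOf h V h4` that only sees the complex fibres holds of a tree-constructed object.
[cite: Deligne1979ShimuraVarieties, 2.1.2–2.1.4 (PDF p. 24 of Milne's translation)] [cite: Liu2021, App. C l. 4599 and Prop. C.5 l. 4627–4628] -/
theorem nonempty_complexRecordSystem_K3 {F : CMField} {ι₁ : F →+* ℂ} (V : HermSpace3 F ι₁) (h4 : 4 ≤ Module.finrank ℚ F) :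
    Nonempty (ComplexRecordSystem F V.Hm ι₁ (Model.frameOf V) (Model.formCongr_frameOf V) (K3 V)) :=
  nonempty_complexRecordSystem_hermSpace3 V h4 (K3 V) (torsionFree_arithmeticLevel_conj_K3 V)

end Summit.HodgeConjecture.CorCM.HComp

end
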